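import Mathlib
import HarnessLib
import Literature.MathematicalPhysics.QuantumLattice.SchwartzPartition
import Literature.MathematicalPhysics.QuantumLattice.SchwartzNuclearExpansionBounds

/-!
# Line `Sketch` (coupling response) of crux `HypercubicLimit`, step Z1-explicit E4: preparations

Helper file for the registered sub-goal `separatedScaleBound_explicit` (stmt-QuantumFields-16154): the
single-scale partition bound for separated test functions with EXPLICIT dependence on the degree `n`.
The explicit version replaces the windows of the non-explicit proof (`separatedScaleBound`) by POLYNOMIAL
weights: a lattice piece `η_β F` of `F ∈ 𝓢((ℝ⁴)ⁿ)` is factorised as `(∏ᵢ θ'_{βᵢ}(xᵢ)) · F♯` with the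
decaying slot cutoffs `θ'_b(z) = (∏_c ρ(z_c - b_c)) (1 + ‖z‖²)^{-(t+4)}` and the fixed weighted test function
`F♯ = (∏ᵢ (1 + ‖xᵢ‖²)^{t+4}) F`.  This file supplies the two analytic inputs with explicit constants:

* `exists_decayingCutoffs` (registered helper): `|θ'_b|_t ≤ A₁(t) ∏_c (1 + |b_c|)^{-2}` — only derivatives
  of the FIXED order `t` of the weight enter (Faà di Bruno bound `norm_iteratedFDeriv_inv_pow_one_add_norm_sq_le`);
* `exists_weightMul`: `|F♯|_{T₀} ≤ (nN+1)^{T₀} 2^{T₀+3nN} |F|_{T₀+2nN}` — the weight is a polynomial, a product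
  of `nN` factors with derivatives `≤ 2(1 + ‖x‖)²` (`norm_iteratedFDeriv_prod_le_pow_card`).
-/

noncomputable section

open scoped SchwartzMap ContDiff
open MeasureTheory Filter Topology Literature.MathematicalPhysics.QuantumLattice

namespace Summit.QuantumFields.YangMills.Cruxes.HypercubicLimit.CouplingResponse

/-- **Explicit Leibniz bound for products.**  If each of the `m = #s` smooth factors `u_i` has all its
derivatives at `x` bounded by `B ≥ 0`, then `‖D^l (∏_{i ∈ s} u_i)(x)‖ ≤ B^m m^l` (induction on `s`:
`‖D^l(u P)‖ ≤ ∑_j (l choose j) ‖D^j u‖ ‖D^{l-j} P‖` and `∑_j (l choose j) m^{l-j} = (m+1)^l`). [folklore] -/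
theorem norm_iteratedFDeriv_prod_le_pow_card {X : Type*} [NormedAddCommGroup X] [NormedSpace ℝ X]
    {ι : Type*} (s : Finset ι) (u : ι → X → ℂ) (hu : ∀ i ∈ s, ContDiff ℝ ∞ (u i)) (x : X)
    {B : ℝ} (hB : 0 ≤ B) (hbd : ∀ i ∈ s, ∀ j : ℕ, ‖iteratedFDeriv ℝ j (u i) x‖ ≤ B) (l : ℕ) :
    ‖iteratedFDeriv ℝ l (fun y => ∏ i ∈ s, u i y) x‖ ≤ B ^ s.card * (s.card : ℝ) ^ l := by
  classical
  induction s using Finset.induction_on generalizing l with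
  | empty =>
    simp only [Finset.prod_empty, Finset.card_empty, pow_zero, one_mul, Nat.cast_zero]
    rcases Nat.eq_zero_or_pos l with rfl | hl
    · rw [norm_iteratedFDeriv_zero, pow_zero, norm_one]
    · rw [iteratedFDeriv_const_of_ne (Nat.pos_iff_ne_zero.1 hl), Pi.zero_apply, norm_zero,
        zero_pow (Nat.pos_iff_ne_zero.1 hl)]
  | insert a s ha ih =>
    have hus : ∀ i ∈ s, ContDiff ℝ ∞ (u i) := fun i hi => hu i (Finset.mem_insert_of_mem hi)
    have hbs : ∀ i ∈ s, ∀ j : ℕ, ‖iteratedFDeriv ℝ j (u i) x‖ ≤ B := fun i hi =>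
      hbd i (Finset.mem_insert_of_mem hi)
    rw [show (fun y => ∏ i ∈ insert a s, u i y) = fun y => u a y * ∏ i ∈ s, u i y from
      funext fun y => Finset.prod_insert ha, Finset.card_insert_of_notMem ha, Nat.cast_succ]
    calc ‖iteratedFDeriv ℝ l (fun y => u a y * ∏ i ∈ s, u i y) x‖
        ≤ ∑ j ∈ Finset.range (l + 1), (l.choose j : ℝ) * ‖iteratedFDeriv ℝ j (u a) x‖ *
            ‖iteratedFDeriv ℝ (l - j) (fun y => ∏ i ∈ s, u i y) x‖ :=
          norm_iteratedFDeriv_mul_le (N := ((⊤ : ℕ∞) : WithTop ℕ∞)) (hu a (Finset.mem_insert_self a s))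
            (contDiff_prod fun i hi => hus i hi) x (mod_cast le_top)
      _ ≤ ∑ j ∈ Finset.range (l + 1), (l.choose j : ℝ) * B * (B ^ s.card * (s.card : ℝ) ^ (l - j)) :=
          Finset.sum_le_sum fun j _ => mul_le_mul (mul_le_mul_of_nonneg_left
            (hbd a (Finset.mem_insert_self a s) j) (Nat.cast_nonneg _)) (ih hus hbs (l - j))
            (norm_nonneg _) (mul_nonneg (Nat.cast_nonneg _) hB)
      _ = B ^ (s.card + 1) * ∑ j ∈ Finset.range (l + 1), (l.choose j : ℝ) * (s.card : ℝ) ^ (l - j) := by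
          rw [pow_succ, Finset.mul_sum]
          exact Finset.sum_congr rfl fun j _ => by ring
      _ = B ^ (s.card + 1) * ((s.card : ℝ) + 1) ^ l := by
          rw [add_comm (s.card : ℝ) 1, add_pow]
          exact congrArg _ (Finset.sum_congr rfl fun j _ => by rw [one_pow, one_mul, mul_comm])

/-- **Derivatives of `z ↦ 1 + ‖z‖²`.**  On a real inner product space the first derivative is
`2⟪z, ·⟫`, the second is the constant form `2⟪·, ·⟫` and the higher ones vanish; in particular
`‖D^j (1 + ‖·‖²)(z)‖ ≤ 2 (1 + ‖z‖)` for `j ≥ 1`. [folklore] -/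
theorem norm_iteratedFDeriv_one_add_norm_sq_le {V : Type*} [NormedAddCommGroup V]
    [InnerProductSpace ℝ V] {j : ℕ} (hj : 1 ≤ j) (z : V) :
    ‖iteratedFDeriv ℝ j (fun z : V => (1 : ℝ) + ‖z‖ ^ 2) z‖ ≤ 2 * (1 + ‖z‖) := by
  obtain ⟨j, rfl⟩ : ∃ i, j = i + 1 := ⟨j - 1, by omega⟩
  set L : V →L[ℝ] V →L[ℝ] ℝ := (2 : ℝ) • (innerSL ℝ (E := V)) with hL
  have hLz : ∀ y : V, ‖L y‖ = 2 * ‖y‖ := fun y => by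
    rw [show L y = (2 : ℝ) • innerSL ℝ y from rfl, norm_smul, Real.norm_two, innerSL_apply_norm]
  have hLn : ‖L‖ ≤ 2 := ContinuousLinearMap.opNorm_le_bound _ zero_le_two fun y => (hLz y).le
  have hf : fderiv ℝ (fun z : V => (1 : ℝ) + ‖z‖ ^ 2) = fun z => L z := by
    funext z
    rw [fderiv_const_add, fderiv_norm_sq_apply]
    change _ = (2 : ℝ) • innerSL ℝ (E := V) z
    first
      | rfl
      | exact (ofNat_smul_eq_nsmul ℝ 2 _).symm
  rw [← norm_iteratedFDeriv_fderiv, hf]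
  rcases j with _ | j
  · rw [norm_iteratedFDeriv_zero, hLz]
    linarith [norm_nonneg z]
  · rw [← norm_iteratedFDeriv_fderiv, show fderiv ℝ (fun z => L z) = fun _ => L from
      funext fun z => L.fderiv]
    rcases j with _ | j
    · rw [norm_iteratedFDeriv_zero]
      linarith [norm_nonneg z]
    · rw [iteratedFDeriv_const_of_ne (by omega), Pi.zero_apply, norm_zero]
      positivity

/-- **Decay of the derivatives of the inverse polynomial weight** `ψ_N(z) = (1 + ‖z‖²)^{-N}`:
`‖D^l ψ_N(z)‖ ≤ l! (N + l + 1)^l (2(1 + ‖z‖))^l (1 + ‖z‖²)^{-N}` (Faà di Bruno bound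
`norm_iteratedFDeriv_comp_le'` for `y ↦ y^{-N}` after `z ↦ 1 + ‖z‖²`, with
`|dⁱ y^{-N} / dyⁱ| = N (N+1) ⋯ (N+i-1) y^{-N-i} ≤ (N+l+1)^l y^{-N}` for `y ≥ 1`). [folklore] -/
theorem norm_iteratedFDeriv_inv_pow_one_add_norm_sq_le {V : Type*} [NormedAddCommGroup V]
    [InnerProductSpace ℝ V] (N l : ℕ) (z : V) :
    ‖iteratedFDeriv ℝ l (fun z : V => ((1 + ‖z‖ ^ 2) ^ N)⁻¹) z‖ ≤
      l.factorial * (((N : ℝ) + l + 1) ^ l * ((1 + ‖z‖ ^ 2) ^ N)⁻¹) * (2 * (1 + ‖z‖)) ^ l := by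
  set f : V → ℝ := fun z => 1 + ‖z‖ ^ 2 with hf_def
  set g : ℝ → ℝ := fun y => y ^ (-(N : ℤ)) with hg_def
  have hfg : (fun z : V => ((1 + ‖z‖ ^ 2) ^ N)⁻¹) = g ∘ f := by
    funext z
    simp only [hg_def, hf_def, Function.comp_apply, zpow_neg, zpow_natCast]
  have hf1 : ∀ z, 1 ≤ f z := fun z => by rw [hf_def]; nlinarith [norm_nonneg z]
  have hft : Set.range f ⊆ Set.Ioi (1 / 2) := by
    rintro _ ⟨z, rfl⟩
    exact lt_of_lt_of_le (by norm_num) (hf1 z)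
  have hg : ContDiffOn ℝ ∞ g (Set.Ioi (1 / 2)) := by
    rw [show g = fun y => (y ^ N)⁻¹ from funext fun y => by simp only [hg_def, zpow_neg, zpow_natCast]]
    exact (contDiffOn_id.pow N).inv fun y hy =>
      pow_ne_zero _ (lt_trans (by norm_num) (Set.mem_Ioi.1 hy)).ne'
  rw [hfg]
  refine norm_iteratedFDeriv_comp_le' hft (uniqueDiffOn_Ioi _) hg
    (contDiff_const.add (contDiff_norm_sq ℝ)) (mod_cast le_top) z (fun i hi => ?_) (fun i hi1 _ => ?_)
  · rw [norm_iteratedFDerivWithin_eq_norm_iteratedDerivWithin,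
      iteratedDerivWithin_of_isOpen_eq_iterate isOpen_Ioi (hft ⟨z, rfl⟩), hg_def,
      iter_deriv_zpow (-(N : ℤ)) (f z) i, norm_mul]
    have hy0 : 0 < f z := lt_of_lt_of_le one_pos (hf1 z)
    have h1 : ‖∏ i' ∈ Finset.range i, (((-(N : ℤ) : ℤ) : ℝ) - i')‖ ≤ ((N : ℝ) + l + 1) ^ l := by
      rw [norm_prod]
      calc ∏ i' ∈ Finset.range i, ‖(((-(N : ℤ) : ℤ) : ℝ) - i')‖
          ≤ ∏ _i' ∈ Finset.range i, ((N : ℝ) + l + 1) := by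
            refine Finset.prod_le_prod (fun _ _ => norm_nonneg _) fun i' hi' => ?_
            have hi'l : (i' : ℝ) ≤ l := by exact_mod_cast (Finset.mem_range.1 hi').le.trans hi
            rw [show (((-(N : ℤ) : ℤ) : ℝ) - i') = -((N : ℝ) + i') by push_cast; ring, norm_neg,
              Real.norm_of_nonneg (by positivity)]
            linarith
        _ = ((N : ℝ) + l + 1) ^ i := by rw [Finset.prod_const, Finset.card_range]
        _ ≤ ((N : ℝ) + l + 1) ^ l := pow_le_pow_right₀ (le_add_of_nonneg_left (by positivity)) hi
    have h2 : ‖f z ^ (-(N : ℤ) - i)‖ ≤ ((1 + ‖z‖ ^ 2) ^ N)⁻¹ := by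
      rw [Real.norm_of_nonneg (zpow_nonneg hy0.le _)]
      calc f z ^ (-(N : ℤ) - i) ≤ f z ^ (-(N : ℤ)) := zpow_le_zpow_right₀ (hf1 z) (by omega)
        _ = ((1 + ‖z‖ ^ 2) ^ N)⁻¹ := by rw [zpow_neg, zpow_natCast]
    exact mul_le_mul h1 h2 (norm_nonneg _) (by positivity)
  · have h2 : (1 : ℝ) ≤ 2 * (1 + ‖z‖) := by nlinarith [norm_nonneg z]
    exact (norm_iteratedFDeriv_one_add_norm_sq_le hi1 z).trans (le_self_pow₀ h2 (by omega))

/-- **Slot cutoffs with polynomial decay (registered helper of `separatedScaleBound_explicit`).**  For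
`b ∈ ℤ⁴` the functions `θ'_b(z) = (∏_c ρ(z_c - b_c)) · (1 + ‖z‖²)^{-(t+4)}` (the one-slot bump of the
lattice partition of unity divided by a polynomial weight) are complex test functions supported in the cube
`{|z_c - b_c| ≤ 1}`, and their Schwartz norms of order `t` DECAY in `b`:
`|θ'_b|_t ≤ A₁ ∏_c (1 + |b_c|)^{-2}` with `A₁ = A₁(t)` (Leibniz: the bump is a translate of a fixed test
function, the weight has derivatives of order `≤ t` bounded by `C_t (1 + ‖z‖)^t (1 + ‖z‖²)^{-(t+4)}`; on the
cube `1 + ‖b‖ ≤ 3 (1 + ‖z‖)`, and `∏_c (1 + |b_c|)² ≤ (1 + ‖b‖)⁸`). [folklore] -/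
theorem exists_decayingCutoffs : ∀ t : ℕ, ∃ A₁ : ℝ, 0 ≤ A₁ ∧ ∀ b : Fin 4 → ℤ, ∃ θ : 𝓢(EuclideanSpace ℝ (Fin 4), ℂ), (∀ z, θ z = (((∏ c, pouBump (z c - b c)) * ((1 + ‖z‖ ^ 2) ^ (t + 4))⁻¹ : ℝ) : ℂ)) ∧ tsupport (θ : EuclideanSpace ℝ (Fin 4) → ℂ) ⊆ {z | ∀ c, |z c - (b c : ℝ)| ≤ 1} ∧ schwartzNorm t θ ≤ A₁ * ∏ c, ((1 + |(b c : ℝ)|) ^ 2)⁻¹ := by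
  intro t
  set Λ₄ : EuclideanSpace ℝ (Fin 4) ≃L[ℝ] EuclideanSpace ℝ (Fin 4) := ContinuousLinearEquiv.refl ℝ _
    with hΛ₄
  set θ₀ : 𝓢(EuclideanSpace ℝ (Fin 4), ℂ) := (NuclearExpansion.hasCompactSupport_etaFun Λ₄ 0).toSchwartzMap
    (NuclearExpansion.contDiff_etaFun Λ₄ 0) with hθ₀
  set N : ℕ := t + 4 with hN
  set ψ : EuclideanSpace ℝ (Fin 4) → ℝ := fun z => ((1 + ‖z‖ ^ 2) ^ N)⁻¹ with hψ
  have hψpos : ∀ z : EuclideanSpace ℝ (Fin 4), 0 < (1 + ‖z‖ ^ 2) ^ N := fun z => by positivity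
  have hψs : ContDiff ℝ ∞ ψ :=
    ((contDiff_const.add (contDiff_norm_sq ℝ)).pow N).inv fun z => (hψpos z).ne'
  set Bθ : ℝ := schwartzNorm t θ₀ with hBθ
  have hBθ0 : 0 ≤ Bθ := schwartzNorm_nonneg _ _
  set Q : ℝ := (t.factorial : ℝ) * ((N : ℝ) + t + 1) ^ t * 2 ^ t with hQ
  refine ⟨2 ^ t * Bθ * Q * 2 ^ N * 3 ^ 8, by positivity, fun b => ?_⟩
  set φ : EuclideanSpace ℝ (Fin 4) → ℂ := fun z => NuclearExpansion.etaFun Λ₄ b z * ((ψ z : ℝ) : ℂ)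
    with hφ
  have hφc : HasCompactSupport φ := (NuclearExpansion.hasCompactSupport_etaFun Λ₄ b).mul_right
  have hφs : ContDiff ℝ ∞ φ := (NuclearExpansion.contDiff_etaFun Λ₄ b).mul (contDiff_ofReal_comp ℂ hψs)
  have hsupp : tsupport φ ⊆ {z | ∀ c, |z c - (b c : ℝ)| ≤ 1} := by
    refine tsupport_mul_subset_left.trans ((tsupport_comp_subset (g := fun r : ℝ => (r : ℂ))
      Complex.ofReal_zero (latticeBump Λ₄ b)).trans fun z hz c => ?_)
    have h := tsupport_latticeBump_subset Λ₄ b hz c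
    exact abs_le.2 ⟨h.1, h.2⟩
  have h0 : 0 ≤ 2 ^ t * Bθ * Q * 2 ^ N * 3 ^ 8 * ∏ c, ((1 + |(b c : ℝ)|) ^ 2)⁻¹ := by positivity
  refine ⟨hφc.toSchwartzMap hφs, fun z => ?_, hsupp, ?_⟩
  · show φ z = _
    simp only [hφ, NuclearExpansion.etaFun, latticeBump, hΛ₄, ContinuousLinearEquiv.refl_apply, hψ]
    push_cast
    ring
  refine Seminorm.finset_sup_apply_le h0 fun kl hkl => ?_
  obtain ⟨hk, hl⟩ := Prod.mk_le_mk.1 (Finset.mem_Iic.1 hkl)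
  rw [SchwartzMap.schwartzSeminormFamily_apply]
  refine SchwartzMap.seminorm_le_bound ℂ kl.1 kl.2 _ h0 fun x => ?_
  change ‖x‖ ^ kl.1 * ‖iteratedFDeriv ℝ kl.2 φ x‖ ≤ _
  by_cases hx : x ∈ tsupport φ
  swap
  · rw [Function.notMem_support.1 fun h => hx (support_iteratedFDeriv_subset kl.2 h), norm_zero, mul_zero]
    exact h0
  -- geometry of the cube around `b`: `1 + ‖b‖ ≤ 3 (1 + ‖x‖)`
  have hb3 : 1 + ‖intVec b‖ ≤ 3 * (1 + ‖x‖) := by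
    have hxb : ‖x - intVec b‖ ≤ √(Fintype.card (Fin 4)) * 1 :=
      EuclideanSpace.norm_le_sqrt_card_mul (x - intVec b) zero_le_one fun c => by
        rw [PiLp.sub_apply, intVec_apply]; exact hsupp hx c
    rw [Fintype.card_fin, Nat.cast_ofNat, show (4 : ℝ) = 2 ^ 2 by norm_num, Real.sqrt_sq zero_le_two] at hxb
    have h1 : ‖intVec b‖ ≤ ‖x‖ + ‖x - intVec b‖ := by
      calc ‖intVec b‖ = ‖x - (x - intVec b)‖ := by rw [sub_sub_cancel]
        _ ≤ ‖x‖ + ‖x - intVec b‖ := norm_sub_le _ _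
    linarith [norm_nonneg x]
  -- derivative bounds of the two factors
  have heta : ∀ j ≤ t, ‖iteratedFDeriv ℝ j (NuclearExpansion.etaFun Λ₄ b) x‖ ≤ Bθ := by
    intro j hj
    have hfun : NuclearExpansion.etaFun Λ₄ b = fun z => θ₀ (z - intVec b) := by
      funext z
      show ((latticeBump Λ₄ b z : ℝ) : ℂ) = ((latticeBump Λ₄ 0 (z - intVec b) : ℝ) : ℂ)
      rw [latticeBump_eq_comp_sub Λ₄ b z]
      rfl
    rw [hfun, iteratedFDeriv_comp_sub]
    exact (SchwartzMap.norm_iteratedFDeriv_le_seminorm ℂ θ₀ j _).trans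
      (seminorm_le_schwartzNorm (Nat.zero_le _) hj θ₀)
  have hx1 : (1 : ℝ) ≤ 1 + ‖x‖ := by linarith [norm_nonneg x]
  have hψ0 : 0 ≤ ψ x := (inv_pos.2 (hψpos x)).le
  have hpsi : ∀ i ≤ t, ‖iteratedFDeriv ℝ i (fun z => ((ψ z : ℝ) : ℂ)) x‖ ≤ Q * (1 + ‖x‖) ^ t * ψ x := by
    intro i hi
    rw [show ‖iteratedFDeriv ℝ i (fun z => ((ψ z : ℝ) : ℂ)) x‖ = ‖iteratedFDeriv ℝ i ψ x‖ from
      norm_iteratedFDeriv_ofReal_comp ℂ hψs i x]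
    refine (norm_iteratedFDeriv_inv_pow_one_add_norm_sq_le N i x).trans ?_
    have h1 : (i.factorial : ℝ) ≤ t.factorial := by exact_mod_cast Nat.factorial_le hi
    have hN1 : (1 : ℝ) ≤ (N : ℝ) + t + 1 := le_add_of_nonneg_left (by positivity)
    have h2 : ((N : ℝ) + i + 1) ^ i ≤ ((N : ℝ) + t + 1) ^ t :=
      (pow_le_pow_left₀ (by positivity) (by linarith [(show (i : ℝ) ≤ t by exact_mod_cast hi)]) i).trans
        (pow_le_pow_right₀ hN1 hi)
    have h3 : (2 * (1 + ‖x‖)) ^ i ≤ 2 ^ t * (1 + ‖x‖) ^ t := by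
      rw [← mul_pow]
      exact pow_le_pow_right₀ (by linarith) hi
    calc (i.factorial : ℝ) * (((N : ℝ) + i + 1) ^ i * ((1 + ‖x‖ ^ 2) ^ N)⁻¹) * (2 * (1 + ‖x‖)) ^ i
        ≤ t.factorial * (((N : ℝ) + t + 1) ^ t * ψ x) * (2 ^ t * (1 + ‖x‖) ^ t) := by rw [hψ]; gcongr
      _ = Q * (1 + ‖x‖) ^ t * ψ x := by rw [hQ]; ring
  -- Leibniz
  have hLeib : ‖iteratedFDeriv ℝ kl.2 φ x‖ ≤ 2 ^ t * Bθ * (Q * (1 + ‖x‖) ^ t * ψ x) := by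
    calc ‖iteratedFDeriv ℝ kl.2 φ x‖
        ≤ ∑ j ∈ Finset.range (kl.2 + 1), (kl.2.choose j : ℝ) *
            ‖iteratedFDeriv ℝ j (NuclearExpansion.etaFun Λ₄ b) x‖ *
            ‖iteratedFDeriv ℝ (kl.2 - j) (fun z => ((ψ z : ℝ) : ℂ)) x‖ :=
          norm_iteratedFDeriv_mul_le (N := ((⊤ : ℕ∞) : WithTop ℕ∞)) (NuclearExpansion.contDiff_etaFun Λ₄ b)
            (contDiff_ofReal_comp ℂ hψs) x (mod_cast le_top)
      _ ≤ ∑ j ∈ Finset.range (kl.2 + 1), (kl.2.choose j : ℝ) * Bθ * (Q * (1 + ‖x‖) ^ t * ψ x) :=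
          Finset.sum_le_sum fun j hj => by
            have hjl : j ≤ kl.2 := Nat.lt_succ_iff.1 (Finset.mem_range.1 hj)
            exact mul_le_mul (mul_le_mul_of_nonneg_left (heta j (hjl.trans hl)) (Nat.cast_nonneg _))
              (hpsi _ ((Nat.sub_le _ _).trans hl)) (norm_nonneg _) (mul_nonneg (Nat.cast_nonneg _) hBθ0)
      _ = 2 ^ kl.2 * Bθ * (Q * (1 + ‖x‖) ^ t * ψ x) := by
          rw [← Finset.sum_mul, ← Finset.sum_mul]
          congr 2
          exact_mod_cast Nat.sum_range_choose kl.2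
      _ ≤ 2 ^ t * Bθ * (Q * (1 + ‖x‖) ^ t * ψ x) :=
          mul_le_mul_of_nonneg_right (mul_le_mul_of_nonneg_right
            (pow_le_pow_right₀ (by norm_num) hl) hBθ0) (by positivity)
  -- weights
  have hxk : ‖x‖ ^ kl.1 ≤ (1 + ‖x‖) ^ t :=
    (pow_le_pow_left₀ (norm_nonneg _) (by linarith) _).trans (pow_le_pow_right₀ hx1 hk)
  have hψu : ψ x ≤ 2 ^ N / (1 + ‖x‖) ^ (2 * N) := by
    have h1 : (1 + ‖x‖) ^ 2 ≤ 2 * (1 + ‖x‖ ^ 2) := by nlinarith [sq_nonneg (1 - ‖x‖)]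
    have h2 : (1 + ‖x‖) ^ (2 * N) ≤ 2 ^ N * (1 + ‖x‖ ^ 2) ^ N := by
      rw [pow_mul, ← mul_pow]; exact pow_le_pow_left₀ (by positivity) h1 N
    rw [hψ]
    dsimp only
    rw [inv_eq_one_div, div_le_div_iff₀ (hψpos x) (by positivity), one_mul]
    exact h2
  have hv : (1 : ℝ) / (1 + ‖x‖) ^ 8 ≤ 3 ^ 8 / (1 + ‖intVec b‖) ^ 8 := by
    rw [div_le_div_iff₀ (by positivity) (by positivity), one_mul]
    calc (1 + ‖intVec b‖) ^ 8 ≤ (3 * (1 + ‖x‖)) ^ 8 := pow_le_pow_left₀ (by positivity) hb3 8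
      _ = 3 ^ 8 * (1 + ‖x‖) ^ 8 := mul_pow _ _ _
  have hprod : (1 : ℝ) / (1 + ‖intVec b‖) ^ 8 ≤ ∏ c, ((1 + |(b c : ℝ)|) ^ 2)⁻¹ := by
    rw [Finset.prod_inv_distrib, one_div]
    refine inv_anti₀ (Finset.prod_pos fun c _ => by positivity) ?_
    have h := prod_one_add_abs_sq_le b
    rwa [Fintype.card_fin] at h
  have hpos : (0 : ℝ) < (1 + ‖x‖) ^ (2 * t) := by positivity
  calc ‖x‖ ^ kl.1 * ‖iteratedFDeriv ℝ kl.2 φ x‖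
      ≤ (1 + ‖x‖) ^ t * (2 ^ t * Bθ * (Q * (1 + ‖x‖) ^ t * ψ x)) :=
        mul_le_mul hxk hLeib (norm_nonneg _) (by positivity)
    _ = 2 ^ t * Bθ * Q * (1 + ‖x‖) ^ (2 * t) * ψ x := by ring
    _ ≤ 2 ^ t * Bθ * Q * (1 + ‖x‖) ^ (2 * t) * (2 ^ N / (1 + ‖x‖) ^ (2 * N)) := by gcongr
    _ = 2 ^ t * Bθ * Q * 2 ^ N * (1 / (1 + ‖x‖) ^ 8) := by
        rw [show 2 * N = 2 * t + 8 by omega]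
        field_simp
        ring
    _ ≤ 2 ^ t * Bθ * Q * 2 ^ N * (3 ^ 8 / (1 + ‖intVec b‖) ^ 8) := by gcongr
    _ = 2 ^ t * Bθ * Q * 2 ^ N * 3 ^ 8 * (1 / (1 + ‖intVec b‖) ^ 8) := by ring
    _ ≤ 2 ^ t * Bθ * Q * 2 ^ N * 3 ^ 8 * ∏ c, ((1 + |(b c : ℝ)|) ^ 2)⁻¹ := by gcongr

/-- **Polynomial weights on the test function.**  For `F ∈ 𝓢((ℝ⁴)ⁿ, ℂ)` the product
`F♯ = (∏ᵢ (1 + ‖xᵢ‖²)^N) · F` is again a test function, with the explicit bound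
`|F♯|_{T₀} ≤ (nN + 1)^{T₀} 2^{T₀ + 3nN} |F|_{T₀ + 2nN}`: the weight is a product of `nN` factors
`1 + ‖xᵢ‖²` whose derivatives are all bounded by `2 (1 + ‖x‖)²`, so `‖D^j W(x)‖ ≤ 2^{nN} (nN)^j (1 + ‖x‖)^{2nN}`
(`norm_iteratedFDeriv_prod_le_pow_card`), and Leibniz with `(1 + ‖x‖)^m ‖D^i F(x)‖ ≤ 2^m |F|_m`
(`SchwartzMap.one_add_le_sup_seminorm_apply`). [folklore] -/
theorem exists_weightMul {n : ℕ} (N : ℕ) (F : 𝓢((Fin n → EuclideanSpace ℝ (Fin 4)), ℂ)) :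
    ∃ G : 𝓢((Fin n → EuclideanSpace ℝ (Fin 4)), ℂ),
      (∀ x, G x = ((∏ i, (1 + ‖x i‖ ^ 2) ^ N : ℝ) : ℂ) * F x) ∧
      ∀ T₀ : ℕ, schwartzNorm T₀ G ≤
        (((n * N : ℕ) : ℝ) + 1) ^ T₀ * 2 ^ (T₀ + 3 * (n * N)) * schwartzNorm (T₀ + 2 * (n * N)) F := by
  set u : Fin n × Fin N → (Fin n → EuclideanSpace ℝ (Fin 4)) → ℂ :=
    fun p x => (((1 : ℝ) + ‖x p.1‖ ^ 2 : ℝ) : ℂ) with hu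
  have hf : ContDiff ℝ ∞ (fun z : EuclideanSpace ℝ (Fin 4) => (1 : ℝ) + ‖z‖ ^ 2) :=
    contDiff_const.add (contDiff_norm_sq ℝ)
  set π : Fin n → (Fin n → EuclideanSpace ℝ (Fin 4)) →L[ℝ] EuclideanSpace ℝ (Fin 4) :=
    fun i => ContinuousLinearMap.proj (R := ℝ) (φ := fun _ : Fin n => EuclideanSpace ℝ (Fin 4)) i with hπ_def
  have hfp : ∀ i : Fin n, ContDiff ℝ ∞ (fun x : Fin n → EuclideanSpace ℝ (Fin 4) => (1 : ℝ) + ‖x i‖ ^ 2) :=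
    fun i => hf.comp (π i).contDiff
  have hus : ∀ p, ContDiff ℝ ∞ (u p) := fun p => contDiff_ofReal_comp ℂ (hfp p.1)
  have hub : ∀ p (j : ℕ) (x : Fin n → EuclideanSpace ℝ (Fin 4)),
      ‖iteratedFDeriv ℝ j (u p) x‖ ≤ 2 * (1 + ‖x‖) ^ 2 := by
    intro p j x
    have hxi : ‖x p.1‖ ≤ ‖x‖ := norm_le_pi_norm x p.1
    rw [hu]
    dsimp only
    rw [show ‖iteratedFDeriv ℝ j (fun x : Fin n → EuclideanSpace ℝ (Fin 4) => (((1 : ℝ) + ‖x p.1‖ ^ 2 : ℝ) : ℂ)) x‖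
        = ‖iteratedFDeriv ℝ j (fun x : Fin n → EuclideanSpace ℝ (Fin 4) => (1 : ℝ) + ‖x p.1‖ ^ 2) x‖ from
      norm_iteratedFDeriv_ofReal_comp ℂ (hfp p.1) j x]
    have hπ : ‖π p.1‖ ≤ 1 := ContinuousLinearMap.opNorm_le_bound _ zero_le_one fun x => by
      rw [one_mul]; exact norm_le_pi_norm x p.1
    rw [show (fun x : Fin n → EuclideanSpace ℝ (Fin 4) => (1 : ℝ) + ‖x p.1‖ ^ 2) =
        (fun z : EuclideanSpace ℝ (Fin 4) => (1 : ℝ) + ‖z‖ ^ 2) ∘ (π p.1) from rfl,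
      (π p.1).iteratedFDeriv_comp_right hf x (i := j) (mod_cast le_top)]
    refine ((ContinuousMultilinearMap.norm_compContinuousLinearMap_le _ _).trans (mul_le_of_le_one_right
      (norm_nonneg _) (Finset.prod_le_one (fun _ _ => norm_nonneg _) fun _ _ => hπ))).trans ?_
    rw [hπ_def, ContinuousLinearMap.proj_apply]
    rcases Nat.eq_zero_or_pos j with rfl | hj
    · rw [norm_iteratedFDeriv_zero, Real.norm_of_nonneg (by positivity)]
      nlinarith [norm_nonneg (x p.1), norm_nonneg x]
    · exact (norm_iteratedFDeriv_one_add_norm_sq_le hj _).trans (by nlinarith [norm_nonneg (x p.1), norm_nonneg x])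
  -- the weight `W = ∏_{(i,m)} (1 + ‖xᵢ‖²)`, its explicit derivative bounds and temperate growth
  set W : (Fin n → EuclideanSpace ℝ (Fin 4)) → ℂ := fun x => ∏ p, u p x with hW
  have hWs : ContDiff ℝ ∞ W := contDiff_prod fun p _ => hus p
  have hWb : ∀ (l : ℕ) (x : Fin n → EuclideanSpace ℝ (Fin 4)), ‖iteratedFDeriv ℝ l W x‖ ≤
      2 ^ (n * N) * (1 + ‖x‖) ^ (2 * (n * N)) * ((n * N : ℕ) : ℝ) ^ l := by
    intro l x
    have h := norm_iteratedFDeriv_prod_le_pow_card Finset.univ u (fun p _ => hus p) x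
      (by positivity : (0 : ℝ) ≤ 2 * (1 + ‖x‖) ^ 2) (fun p _ j => hub p j x) l
    rw [Finset.card_univ, Fintype.card_prod, Fintype.card_fin, Fintype.card_fin, mul_pow, ← pow_mul] at h
    exact h
  have hWg : W.HasTemperateGrowth := ⟨hWs, fun l => ⟨2 * (n * N), 2 ^ (n * N) * ((n * N : ℕ) : ℝ) ^ l,
    fun x => (hWb l x).trans_eq (by ring)⟩⟩
  have hfun : ((SchwartzMap.smulLeftCLM ℂ W F : 𝓢((Fin n → EuclideanSpace ℝ (Fin 4)), ℂ)) :
      (Fin n → EuclideanSpace ℝ (Fin 4)) → ℂ) = fun x => W x * F x := by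
    ext x
    rw [SchwartzMap.smulLeftCLM_apply_apply hWg, smul_eq_mul]
  refine ⟨SchwartzMap.smulLeftCLM ℂ W F, fun x => ?_, fun T₀ => ?_⟩
  · rw [hfun]
    dsimp only
    rw [hW, hu]
    dsimp only
    rw [Fintype.prod_prod_type]
    simp only [Finset.prod_const, Finset.card_univ, Fintype.card_fin]
    push_cast
    rfl
  -- the norm bound
  set T' : ℕ := T₀ + 2 * (n * N) with hT'
  have hF0 : 0 ≤ schwartzNorm T' F := schwartzNorm_nonneg _ _
  have h0 : 0 ≤ (((n * N : ℕ) : ℝ) + 1) ^ T₀ * 2 ^ (T₀ + 3 * (n * N)) * schwartzNorm T' F := by positivity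
  refine Seminorm.finset_sup_apply_le h0 fun kl hkl => ?_
  obtain ⟨hk, hl⟩ := Prod.mk_le_mk.1 (Finset.mem_Iic.1 hkl)
  rw [SchwartzMap.schwartzSeminormFamily_apply]
  refine SchwartzMap.seminorm_le_bound ℂ kl.1 kl.2 _ h0 fun x => ?_
  rw [hfun]
  have hx1 : ‖x‖ ≤ 1 + ‖x‖ := by linarith [norm_nonneg x]
  calc ‖x‖ ^ kl.1 * ‖iteratedFDeriv ℝ kl.2 (fun y => W y * F y) x‖
      ≤ ‖x‖ ^ kl.1 * ∑ j ∈ Finset.range (kl.2 + 1), (kl.2.choose j : ℝ) *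
          ‖iteratedFDeriv ℝ j W x‖ * ‖iteratedFDeriv ℝ (kl.2 - j) F x‖ :=
        mul_le_mul_of_nonneg_left (norm_iteratedFDeriv_mul_le (N := ((⊤ : ℕ∞) : WithTop ℕ∞)) hWs
          (F.smooth ⊤) x (mod_cast le_top)) (by positivity)
    _ ≤ ‖x‖ ^ kl.1 * ∑ j ∈ Finset.range (kl.2 + 1), (kl.2.choose j : ℝ) *
          (2 ^ (n * N) * (1 + ‖x‖) ^ (2 * (n * N)) * ((n * N : ℕ) : ℝ) ^ j) *
          ‖iteratedFDeriv ℝ (kl.2 - j) F x‖ := by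
        gcongr with j hj
        exact hWb j x
    _ = ∑ j ∈ Finset.range (kl.2 + 1), (kl.2.choose j : ℝ) * ((n * N : ℕ) : ℝ) ^ j * 2 ^ (n * N) *
          ((1 + ‖x‖) ^ (2 * (n * N)) * (‖x‖ ^ kl.1 * ‖iteratedFDeriv ℝ (kl.2 - j) F x‖)) := by
        rw [Finset.mul_sum]
        exact Finset.sum_congr rfl fun j _ => by ring
    _ ≤ ∑ j ∈ Finset.range (kl.2 + 1), (kl.2.choose j : ℝ) * ((n * N : ℕ) : ℝ) ^ j * 2 ^ (n * N) *
          (2 ^ T' * schwartzNorm T' F) := by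
        refine Finset.sum_le_sum fun j hj => mul_le_mul_of_nonneg_left ?_ (by positivity)
        have hjl : j ≤ kl.2 := Nat.lt_succ_iff.1 (Finset.mem_range.1 hj)
        calc (1 + ‖x‖) ^ (2 * (n * N)) * (‖x‖ ^ kl.1 * ‖iteratedFDeriv ℝ (kl.2 - j) F x‖)
            ≤ (1 + ‖x‖) ^ (2 * (n * N)) * ((1 + ‖x‖) ^ kl.1 * ‖iteratedFDeriv ℝ (kl.2 - j) F x‖) := by
              gcongr
          _ = (1 + ‖x‖) ^ (2 * (n * N) + kl.1) * ‖iteratedFDeriv ℝ (kl.2 - j) F x‖ := by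
              rw [pow_add]; ring
          _ ≤ 2 ^ ((T', T') : ℕ × ℕ).1 *
                (Finset.Iic ((T', T') : ℕ × ℕ)).sup (fun m => SchwartzMap.seminorm ℂ m.1 m.2) F :=
              SchwartzMap.one_add_le_sup_seminorm_apply (by show 2 * (n * N) + kl.1 ≤ T'; omega)
                (by show kl.2 - j ≤ T'; omega) F x
          _ = 2 ^ T' * schwartzNorm T' F := rfl
    _ = (((n * N : ℕ) : ℝ) + 1) ^ kl.2 * 2 ^ (n * N) * (2 ^ T' * schwartzNorm T' F) := by
        rw [← Finset.sum_mul, ← Finset.sum_mul, add_pow]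
        exact congrArg (· * _ * _) (Finset.sum_congr rfl fun j _ => by rw [one_pow, mul_one, mul_comm])
    _ = (((n * N : ℕ) : ℝ) + 1) ^ kl.2 * 2 ^ (T₀ + 3 * (n * N)) * schwartzNorm T' F := by
        rw [show T₀ + 3 * (n * N) = n * N + T' by omega, pow_add 2 (n * N) T']
        ring
    _ ≤ (((n * N : ℕ) : ℝ) + 1) ^ T₀ * 2 ^ (T₀ + 3 * (n * N)) * schwartzNorm T' F := by
        exact mul_le_mul_of_nonneg_right (mul_le_mul_of_nonneg_right
          (pow_le_pow_right₀ (le_add_of_nonneg_left (by positivity)) hl) (by positivity)) hF0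

end Summit.QuantumFields.YangMills.Cruxes.HypercubicLimit.CouplingResponse

end
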